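import Summits.QuantumFields.BalabanUV.T4Continuum.Support.NE7ExpansionSegmentLetters
import Summits.QuantumFields.BalabanUV.T4Continuum.Support.NE7ExpansionStructure
import Literature.NumberTheory.Sieve.CoprimeSquarefreeSumsBounds
import HarnessLib

/-!
# NE7ExpansionRemainderFlat — THE STRONG EXPANSION LETTER (EXP) OF F38's BUNDLE AT THE TRIVIAL FLAT DATUM, IN KERNEL:
# `|dAction (e^{A}) Y − hess 1 A Y| ≤ ρ(α₀, α₁, d)·‖Y‖_{ℓ¹}` over one period, with `ρ = O(α₀α₁ + α₀³ + α₁² + α₀²α₁ + α₀⁴)` — in the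
# currencies `α₀ = α̂M⁻¹`, `α₁ = α̂₁M⁻²` every term of `ρ` is `O(M⁻³)`, the density the slice solver tolerates (memo H14 §1 FACT 2)

Cell `pub-balaban`, rung (B)+1 sub-cell t4, lineage `b2b-balaban-t4-ne7-p1`, generation 71 (CRUX PROVER NE7 #1); memo
`t4/b2b-balaban-t4-ne7-p1-g70/HUNT-H14-APE-FLAT-SKELETON.md` §1 FACT 2 and §7 (the refined EXP plan).  File F48b (over F48a
`NE7ExpansionSegmentLetters` (the by-parts letter at the flat background, the window sum of the bond sums, the letters along the segment `e^{sA}`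
including the Taylor tail of the curl — themselves over F46 `NE7CubicVertexLetters` and F47 `NE7DcurlBaseLipschitz`), F45 `NE7ExpansionStructure`
(the mean-value reduction `abs_dAction_vary_sub_hess_le_flat` and the two-channel split `hessPlaqAt_sub_flat_eq`), F46
(`norm_dcurlAt_flat_self_sub_shift_le`: the ADJACENT DIFFERENCES `≤ 64α₀α₁` of `𝒬(A) = dcurlAt 1 A A`), row NE3's
`NE3CurlStability.norm_curlAt_vary_sub_le`, `NE3HessContinuity.norm_dcurlAt_le`, `NE3HessBounds.norm_curlAt_le`).
WHY.  F38 `NE7ApeFlatSkeleton` ∕ F44 `smallField_vary_of_flatLetters'` ask the expansion letter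
`hEXP : |dAction (F̃e^{A}) Y (perWin d P) − hess F̃ A Y (perWin d P)| ≤ ρ·dirL1 Y (periodBox P)` for every skew periodic `Y`, and the bootstrap
closes only if `ρ ≲ M⁻³` (`radius_currency`: the slice solver costs `K·M`).  The WEAK remainder (Lipschitz of `hess` in the base paired with
`‖d Y‖ ≤ bl₁(Y)`) is `Cα₀² = Cα̂²M⁻²` — one power of `M` short — because of ONE term, the cubic vertex `Σ_p Re tr[(d_1Y)(p)·𝒬(A)(p)]`.  THIS FILE
proves the STRONG form at the trivial flat datum `F̃ = 1`: the cubic vertex is moved onto `Y` by the (flat, periodic) summation by parts (F48a), where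
it costs the adjacent differences of `𝒬(A)` — `64α₀α₁` by F46 — and everything else is a product of two small letters (F48a §2).
WHAT ([folklore] lattice calculus; 0 def, 0 sorry; §1–§2 are F48a's).
§3 **`abs_hessPlaqAt_vary_sub_flat_add_le`** — per plaquette: `|hessPlaqAt V_s A Y − hessPlaqAt 1 A Y + Re tr[(d_1Y)·s𝒬(A)]∕N| ≤ c_loc·bl₁(Y)`,
   `c_loc = 8α₀(2α₁+28α₀²) + 6δ(2α₁+24δα₀) + (2α₁+24δα₀)(2α₁+28α₀²) + 960δα₀²` (F45's split; the identity
   `abh − a₀b₀ = (a−a₀)bh + a₀b(h−1) + a₀(b−b₀−q) + a₀q`).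
§4 **`abs_hess_vary_sub_hess_flat_le`** (`|hess V_s A Y W − hess 1 A Y W| ≤ ρ‖Y‖_{ℓ¹}`, `W = perWin d P`,
   `ρ = #Plane·(2c_loc + 64α₀α₁)`) and **`abs_dAction_vary_sub_hess_flat_le`** = THE (EXP) LETTER OF F38∕F44 AT `F̃ = 1`:
   `|dAction (e^{A}) Y W − hess 1 A Y W| ≤ ρ·dirL1 Y (periodBox P)` for every skew `P`-periodic `Y` (F45 §1).
§5 **`rho_currency`** (`e^{x} − 1 ≤ 2x` reused from `Literature.NumberTheory.Sieve.SquarefreeSums`): with `M ≥ 1`, `0 ≤ α₀ ≤ α̂∕M`, `0 ≤ α₁ ≤ α̂₁∕M²`, `α̂ ≤ 1`: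
   `ρ ≤ #Plane·(144α̂α̂₁ + 5440α̂³ + 8α̂₁² + 304α̂²α̂₁ + 2688α̂⁴)∕M³` — F38 §4's currency clause `ρ ≤ ρ̂∕M³`.
HONEST FRAMING (page 1): lattice calculus at the TRIVIAL flat datum (the commuting-holonomy twist is NOT here); the gradient currency `α₁` of the
representative is a HYPOTHESIS (B8 (1.36) ∕ B11 (152) TYPE, the REP♭ letter — not proved here); nothing of Bałaban's asserted; NOT (APE), NOT ONE-STEP,
NOT NE7; spine 0∕9; finite T⁴ rung (B)+1 — NOT infinite volume, NOT mass gap, NOT Clay.  Continuum YM on T⁴ ⇐ BetaPertH ∧ nine spine estimates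
(0/9 proved); BetaPertH ⇐ (D1) ∧ (D4) ∧ CAP+tail; G-an2-4 gates asym, D1 and NE2/3/4.
-/

set_option autoImplicit false

open scoped BigOperators Matrix.Norms.L2Operator
open NormedSpace Finset Set

namespace Summit.QuantumFields.BalabanUV.T4Continuum.NE7ExpansionRemainderFlat

open Literature.MathematicalPhysics.QuantumFieldTheory.Balaban1983to89
open B7Prop1Explicit B7Prop2Explicit MatrixLog UnitaryModel
open T4AveragingDeficitWall (IsUnitaryCfg IsSkewDir SmallField vary curlAt dirL1)
open T4AveragingDeficitWallBoundary (periodBox)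
open AveragingDeficitPeriodicCounting (IsPeriodicDir)
open AveragingDeficitTransport (mem_U1_of_unitary)
open AveragingDeficitPlaqDeriv (vary_isUnitaryCfg)
open AveragingDeficitNearIdentity (abs_nReTr_mul_le)
open MinimalActionLevels (perWin)
open NE3HessForm (hess hessPlaq hessPlaqAt dcurlAt dAction)
open NE3HessBounds (norm_curlAt_le)
open NE3HessContinuity (bondL1At bondL1At_nonneg norm_dcurlAt_le)
open NE3CurlStability (norm_curlAt_vary_sub_le)
open BlockAveragePushDirSplit (flat)
open NE7ExpansionStructure (abs_dAction_vary_sub_hess_le_flat hessPlaqAt_sub_flat_eq)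
open NE7CubicVertexLetters (isUnitaryCfg_flat bondL1At_le_of_sup norm_dcurlAt_flat_self_sub_shift_le)
open NE7ExpansionSegmentLetters (sum_perWin_bondL1At_le abs_sum_nReTr_curlAt_flat_mul_le smallField_flat_zero norm_curlAt_vary_flat_le
  norm_hol_vary_flat_sub_one_le norm_curlAt_vary_flat_taylor_le dcurlAt_flat_self_periodic)

noncomputable section

variable {d : ℕ} {n : Type*} [Fintype n] [DecidableEq n]

/-! ## §3 The per-plaquette bound: everything but the cubic vertex is a product of two small letters -/

/-- **PER PLAQUETTE** (`μ ≠ ν`, `s ∈ [0,1]`, `A` skew with `‖A‖ ≤ α₀` and lattice differences `≤ α₁`, `δ = e^{α₀} − 1`):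
`|hessPlaqAt V_s A Y p − hessPlaqAt 1 A Y p + Re tr[(d_1Y)(p)·(s·𝒬(A)(p))]∕N| ≤ c_loc·bl₁(Y)(p)` with
`c_loc = 8α₀(2α₁ + 28α₀²) + 6δ(2α₁ + 24δα₀) + (2α₁ + 24δα₀)(2α₁ + 28α₀²) + 960δα₀²`: F45's two-channel split at the flat background; the
traceless channel `‖dcurlAt_s A Y‖·‖hol_s − 1‖`; the curl–curl channel by the identity `abh − a₀b₀ = (a−a₀)bh + a₀b(h−1) + a₀(b−b₀−q) + a₀q`
with `a = d_sY`, `b = d_sA`, `h = hol_s`, `q = s𝒬(A)`, every factor bounded by §2. [folklore] -/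
theorem abs_hessPlaqAt_vary_sub_flat_add_le [Nonempty n] {A : Site d → Fin d → Matrix n n ℂ} (hA : IsSkewDir A) {α₀ α₁ : ℝ}
    (hAα : ∀ y κ, ‖A y κ‖ ≤ α₀) (hA1 : ∀ (y : Site d) (κ τ : Fin d), ‖A (y + e τ) κ - A y κ‖ ≤ α₁)
    (Y : Site d → Fin d → Matrix n n ℂ) {s : ℝ} (hs : s ∈ Icc (0 : ℝ) 1) (z : Site d) {μ ν : Fin d} (hμν : μ ≠ ν) :
    |hessPlaqAt (vary (flat (d := d) (n := n)) A s) A Y z μ ν - hessPlaqAt (flat (d := d) (n := n)) A Y z μ ν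
        + nReTr (curlAt (flat (d := d) (n := n)) Y z μ ν * (s • dcurlAt (flat (d := d) (n := n)) A A z μ ν))|
      ≤ (8 * α₀ * (2 * α₁ + 28 * α₀ ^ 2) + 6 * (Real.exp α₀ - 1) * (2 * α₁ + 24 * (Real.exp α₀ - 1) * α₀)
          + (2 * α₁ + 24 * (Real.exp α₀ - 1) * α₀) * (2 * α₁ + 28 * α₀ ^ 2) + 960 * (Real.exp α₀ - 1) * α₀ ^ 2)
        * bondL1At Y z μ ν := by
  have hα : 0 ≤ α₀ := (norm_nonneg _).trans (hAα z μ)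
  have hα1 : 0 ≤ α₁ := (norm_nonneg _).trans (hA1 z μ μ)
  -- the letters, stated before the abbreviations
  have lb := norm_curlAt_vary_flat_le (d := d) (n := n) hA hAα hA1 hs z μ ν
  have lh1 := norm_hol_vary_flat_sub_one_le (d := d) (n := n) hA hAα hA1 hs z hμν
  have lt := norm_curlAt_vary_flat_taylor_le (d := d) (n := n) hA hAα hs z μ ν
  have la' := norm_curlAt_vary_sub_le (isUnitaryCfg_flat (d := d) (n := n)) hA hAα s Y z μ ν
  have la₀' := norm_curlAt_le (isUnitaryCfg_flat (d := d) (n := n)) Y z μ ν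
  have hVsu : IsUnitaryCfg (vary (flat (d := d) (n := n)) A s) := vary_isUnitaryCfg (isUnitaryCfg_flat (d := d) (n := n)) hA s
  have ldc' := norm_dcurlAt_le hVsu A Y z μ ν
  have lh : ‖((hol (vary (flat (d := d) (n := n)) A s) z (plaqWord μ ν) : (Matrix n n ℂ)ˣ) : Matrix n n ℂ)‖ ≤ 1 :=
    (mem_U1_of_unitary (hol_mem_of (S := unitaryUnits (Matrix n n ℂ)) (fun y κ => hVsu y κ) z (plaqWord μ ν))).1
  -- F45's split at the flat background
  have hsplit := hessPlaqAt_sub_flat_eq (smallField_flat_zero (d := d) (n := n)) (vary (flat (d := d) (n := n)) A s) A Y z hμν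
  -- abbreviations
  set δ : ℝ := Real.exp α₀ - 1 with hδdef
  have hδ : 0 ≤ δ := by rw [hδdef]; linarith [Real.one_le_exp hα]
  set a : Matrix n n ℂ := curlAt (vary (flat (d := d) (n := n)) A s) Y z μ ν
  set a₀ : Matrix n n ℂ := curlAt (flat (d := d) (n := n)) Y z μ ν
  set b : Matrix n n ℂ := curlAt (vary (flat (d := d) (n := n)) A s) A z μ ν
  set b₀ : Matrix n n ℂ := curlAt (flat (d := d) (n := n)) A z μ ν
  set hh : Matrix n n ℂ := ((hol (vary (flat (d := d) (n := n)) A s) z (plaqWord μ ν) : (Matrix n n ℂ)ˣ) : Matrix n n ℂ)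
  set q : Matrix n n ℂ := s • dcurlAt (flat (d := d) (n := n)) A A z μ ν
  set dc : Matrix n n ℂ := dcurlAt (vary (flat (d := d) (n := n)) A s) A Y z μ ν
  -- sizes
  have lY : 0 ≤ bondL1At Y z μ ν := bondL1At_nonneg Y z μ ν
  have la : ‖a - a₀‖ ≤ 6 * δ * bondL1At Y z μ ν := by
    have hs1 : |s| ≤ 1 := abs_le.mpr ⟨by linarith [hs.1], hs.2⟩
    have hexp : Real.exp (|s| * α₀) - 1 ≤ δ := by
      have : |s| * α₀ ≤ α₀ := by nlinarith
      rw [hδdef]; linarith [Real.exp_le_exp.mpr this]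
    exact la'.trans (mul_le_mul_of_nonneg_right (mul_le_mul_of_nonneg_left hexp (by norm_num)) lY)
  have la₀ : ‖a₀‖ ≤ bondL1At Y z μ ν := by unfold bondL1At; exact la₀'
  have ldc : ‖dc‖ ≤ 8 * α₀ * bondL1At Y z μ ν := by
    have hbA : bondL1At A z μ ν ≤ 4 * α₀ := bondL1At_le_of_sup hAα z μ ν
    have hm := mul_le_mul_of_nonneg_right hbA lY
    calc ‖dc‖ ≤ 2 * (bondL1At A z μ ν * bondL1At Y z μ ν) := ldc'
      _ ≤ 2 * ((4 * α₀) * bondL1At Y z μ ν) := by linarith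
      _ = 8 * α₀ * bondL1At Y z μ ν := by ring
  have hB : 0 ≤ 2 * α₁ + 24 * δ * α₀ := by positivity
  have hH : 0 ≤ 2 * α₁ + 28 * α₀ ^ 2 := by positivity
  -- the curl channel identity
  have e2 : a * b * hh - a₀ * b₀ = (a - a₀) * b * hh + a₀ * b * (hh - 1) + a₀ * (b - b₀ - q) + a₀ * q := by noncomm_ring
  have e3 : nReTr (a * b * hh) - nReTr (a₀ * b₀)
      = nReTr ((a - a₀) * b * hh) + nReTr (a₀ * b * (hh - 1)) + nReTr (a₀ * (b - b₀ - q)) + nReTr (a₀ * q) := by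
    rw [← T4TiltOscillation.nReTr_sub, e2, T4TiltOscillation.nReTr_add, T4TiltOscillation.nReTr_add, T4TiltOscillation.nReTr_add]
  have hgoal : hessPlaqAt (vary (flat (d := d) (n := n)) A s) A Y z μ ν - hessPlaqAt (flat (d := d) (n := n)) A Y z μ ν + nReTr (a₀ * q)
      = -nReTr (dc * (hh - 1)) - (nReTr ((a - a₀) * b * hh) + nReTr (a₀ * b * (hh - 1)) + nReTr (a₀ * (b - b₀ - q))) := by
    rw [hsplit]; linarith
  rw [hgoal]
  -- the four trace bounds
  have t1 : |nReTr (dc * (hh - 1))| ≤ 8 * α₀ * (2 * α₁ + 28 * α₀ ^ 2) * bondL1At Y z μ ν := by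
    refine (abs_nReTr_mul_le _ _).trans ?_
    calc ‖dc‖ * ‖hh - 1‖ ≤ (8 * α₀ * bondL1At Y z μ ν) * (2 * α₁ + 28 * α₀ ^ 2) := mul_le_mul ldc lh1 (norm_nonneg _) (by positivity)
      _ = 8 * α₀ * (2 * α₁ + 28 * α₀ ^ 2) * bondL1At Y z μ ν := by ring
  have t2 : |nReTr ((a - a₀) * b * hh)| ≤ 6 * δ * (2 * α₁ + 24 * δ * α₀) * bondL1At Y z μ ν := by
    refine (abs_nReTr_mul_le _ _).trans ?_
    have hab : ‖(a - a₀) * b‖ ≤ (6 * δ * bondL1At Y z μ ν) * (2 * α₁ + 24 * δ * α₀) :=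
      (norm_mul_le _ _).trans (mul_le_mul la lb (norm_nonneg _) (by positivity))
    calc ‖(a - a₀) * b‖ * ‖hh‖ ≤ ((6 * δ * bondL1At Y z μ ν) * (2 * α₁ + 24 * δ * α₀)) * 1 :=
          mul_le_mul hab lh (norm_nonneg _) (by positivity)
      _ = 6 * δ * (2 * α₁ + 24 * δ * α₀) * bondL1At Y z μ ν := by ring
  have t3 : |nReTr (a₀ * b * (hh - 1))| ≤ (2 * α₁ + 24 * δ * α₀) * (2 * α₁ + 28 * α₀ ^ 2) * bondL1At Y z μ ν := by
    refine (abs_nReTr_mul_le _ _).trans ?_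
    have hab : ‖a₀ * b‖ ≤ bondL1At Y z μ ν * (2 * α₁ + 24 * δ * α₀) :=
      (norm_mul_le _ _).trans (mul_le_mul la₀ lb (norm_nonneg _) lY)
    calc ‖a₀ * b‖ * ‖hh - 1‖ ≤ (bondL1At Y z μ ν * (2 * α₁ + 24 * δ * α₀)) * (2 * α₁ + 28 * α₀ ^ 2) :=
          mul_le_mul hab lh1 (norm_nonneg _) (by positivity)
      _ = (2 * α₁ + 24 * δ * α₀) * (2 * α₁ + 28 * α₀ ^ 2) * bondL1At Y z μ ν := by ring
  have t4 : |nReTr (a₀ * (b - b₀ - q))| ≤ 960 * δ * α₀ ^ 2 * bondL1At Y z μ ν := by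
    refine (abs_nReTr_mul_le _ _).trans ?_
    calc ‖a₀‖ * ‖b - b₀ - q‖ ≤ bondL1At Y z μ ν * (960 * δ * α₀ ^ 2) := mul_le_mul la₀ lt (norm_nonneg _) lY
      _ = 960 * δ * α₀ ^ 2 * bondL1At Y z μ ν := by ring
  have habs : |-nReTr (dc * (hh - 1)) - (nReTr ((a - a₀) * b * hh) + nReTr (a₀ * b * (hh - 1)) + nReTr (a₀ * (b - b₀ - q)))|
      ≤ |nReTr (dc * (hh - 1))| + (|nReTr ((a - a₀) * b * hh)| + |nReTr (a₀ * b * (hh - 1))| + |nReTr (a₀ * (b - b₀ - q))|) := by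
    refine (abs_sub _ _).trans ?_
    rw [abs_neg]
    refine add_le_add le_rfl ?_
    exact (abs_add_le _ _).trans (add_le_add (abs_add_le _ _) le_rfl)
  refine habs.trans ?_
  have := add_le_add t1 (add_le_add (add_le_add t2 t3) t4)
  refine this.trans (le_of_eq ?_)
  ring

/-! ## §4 THE END: the strong expansion letter at the trivial flat datum -/

/-- **`|hess V_s A Y W − hess 1 A Y W| ≤ ρ·‖Y‖_{ℓ¹(periodBox P)}`** for `W = perWin d P`, `s ∈ [0,1]`, `A` skew `P`-periodic with `‖A‖ ≤ α₀` and
lattice differences `≤ α₁` (`0 ≤ α₀, α₁`), `Y` `P`-periodic: §3 per plaquette, §1's window sum of `bl₁(Y)`, and §1's by-parts letter for the cubic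
vertex with `γ = 64α₀α₁` (F46 `norm_dcurlAt_flat_self_sub_shift_le`; `|s| ≤ 1`).  `ρ = #Plane·(2c_loc + 64α₀α₁)`, `c_loc` as in §3. [folklore] -/
theorem abs_hess_vary_sub_hess_flat_le [Nonempty n] {P : ℕ} (hP : 1 ≤ P) {A : Site d → Fin d → Matrix n n ℂ} (hA : IsSkewDir A)
    (hAP : IsPeriodicDir A (P : ℤ)) {α₀ α₁ : ℝ} (hα₀ : 0 ≤ α₀) (hα₁ : 0 ≤ α₁)
    (hAα : ∀ y κ, ‖A y κ‖ ≤ α₀) (hA1 : ∀ (y : Site d) (κ τ : Fin d), ‖A (y + e τ) κ - A y κ‖ ≤ α₁)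
    {Y : Site d → Fin d → Matrix n n ℂ} (hYP : IsPeriodicDir Y (P : ℤ)) {s : ℝ} (hs : s ∈ Icc (0 : ℝ) 1) :
    |hess (vary (flat (d := d) (n := n)) A s) A Y (perWin d P) - hess (flat (d := d) (n := n)) A Y (perWin d P)|
      ≤ (Fintype.card (T4AveragingDeficitWall.Plane d) : ℝ)
          * (2 * (8 * α₀ * (2 * α₁ + 28 * α₀ ^ 2) + 6 * (Real.exp α₀ - 1) * (2 * α₁ + 24 * (Real.exp α₀ - 1) * α₀)
              + (2 * α₁ + 24 * (Real.exp α₀ - 1) * α₀) * (2 * α₁ + 28 * α₀ ^ 2) + 960 * (Real.exp α₀ - 1) * α₀ ^ 2)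
            + 64 * α₀ * α₁)
        * dirL1 Y (periodBox (d := d) P) := by
  -- the per-plaquette letters (stated before the abbreviations)
  have hEp' := fun (p : T4AveragingDeficitWall.Plaq d) =>
    abs_hessPlaqAt_vary_sub_flat_add_le (d := d) (n := n) hA hAα hA1 Y hs p.1 (ne_of_lt p.2.2)
  set δ : ℝ := Real.exp α₀ - 1 with hδdef
  have hδ : 0 ≤ δ := by rw [hδdef]; linarith [Real.one_le_exp hα₀]
  set cloc : ℝ := 8 * α₀ * (2 * α₁ + 28 * α₀ ^ 2) + 6 * δ * (2 * α₁ + 24 * δ * α₀)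
    + (2 * α₁ + 24 * δ * α₀) * (2 * α₁ + 28 * α₀ ^ 2) + 960 * δ * α₀ ^ 2 with hcloc
  have hcloc0 : 0 ≤ cloc := by rw [hcloc]; positivity
  set G : Site d → Fin d → Fin d → Matrix n n ℂ := fun z μ ν => s • dcurlAt (flat (d := d) (n := n)) A A z μ ν with hG
  -- the error term per plaquette
  set E : T4AveragingDeficitWall.Plaq d → ℝ := fun p =>
    hessPlaqAt (vary (flat (d := d) (n := n)) A s) A Y p.1 p.2.1.1 p.2.1.2 - hessPlaqAt (flat (d := d) (n := n)) A Y p.1 p.2.1.1 p.2.1.2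
      + nReTr (curlAt (flat (d := d) (n := n)) Y p.1 p.2.1.1 p.2.1.2 * G p.1 p.2.1.1 p.2.1.2) with hE
  have hdecomp : hess (vary (flat (d := d) (n := n)) A s) A Y (perWin d P) - hess (flat (d := d) (n := n)) A Y (perWin d P)
      = ∑ p ∈ perWin d P, E p - ∑ p ∈ perWin d P, nReTr (curlAt (flat (d := d) (n := n)) Y p.1 p.2.1.1 p.2.1.2 * G p.1 p.2.1.1 p.2.1.2) := by
    unfold hess
    rw [← Finset.sum_sub_distrib, ← Finset.sum_sub_distrib]
    refine Finset.sum_congr rfl fun p _ => ?_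
    simp only [hE, hessPlaq]
    ring
  -- the per-plaquette bound
  have hEp : ∀ p ∈ perWin d P, |E p| ≤ cloc * bondL1At Y p.1 p.2.1.1 p.2.1.2 := fun p _ => hEp' p
  -- the by-parts letter
  have hGP : ∀ (z : Site d) (κ μ ν : Fin d), G (z + (P : ℤ) • e κ) μ ν = G z μ ν := by
    intro z κ μ ν
    simp only [hG, dcurlAt_flat_self_periodic (n := n) hAP z κ μ ν]
  have hGd : ∀ (z : Site d) (μ ν τ : Fin d), ‖G z μ ν - G (z - e τ) μ ν‖ ≤ 64 * α₀ * α₁ := by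
    intro z μ ν τ
    simp only [hG]
    rw [← smul_sub, norm_smul, Real.norm_eq_abs]
    have h := norm_dcurlAt_flat_self_sub_shift_le (n := n) hAα hA1 z μ ν τ
    have hs1 : |s| ≤ 1 := abs_le.mpr ⟨by linarith [hs.1], hs.2⟩
    have h0 : 0 ≤ ‖dcurlAt (flat (d := d) (n := n)) A A z μ ν - dcurlAt (flat (d := d) (n := n)) A A (z - e τ) μ ν‖ := norm_nonneg _
    calc |s| * ‖dcurlAt (flat (d := d) (n := n)) A A z μ ν - dcurlAt (flat (d := d) (n := n)) A A (z - e τ) μ ν‖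
        ≤ 1 * (64 * α₀ * α₁) := mul_le_mul hs1 h h0 (by norm_num)
      _ = 64 * α₀ * α₁ := one_mul _
  have hparts := abs_sum_nReTr_curlAt_flat_mul_le (n := n) hP hYP hGP hGd
  have hwin := sum_perWin_bondL1At_le (n := n) hP hYP
  rw [hdecomp]
  refine (abs_sub _ _).trans ?_
  have hE1 : |∑ p ∈ perWin d P, E p| ≤ cloc * (2 * (Fintype.card (T4AveragingDeficitWall.Plane d) : ℝ) * dirL1 Y (periodBox (d := d) P)) := by
    refine (Finset.abs_sum_le_sum_abs _ _).trans ?_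
    refine (Finset.sum_le_sum hEp).trans ?_
    rw [← Finset.mul_sum]
    exact mul_le_mul_of_nonneg_left hwin hcloc0
  have := add_le_add hE1 hparts
  refine this.trans (le_of_eq ?_)
  rw [hcloc]; ring

/-- **(EXP) AT THE TRIVIAL FLAT DATUM — THE STRONG EXPANSION LETTER OF F38 `NE7ApeFlatSkeleton` ∕ F44 `smallField_vary_of_flatLetters'`
AT `F̃ = 1`, IN KERNEL.**  For `P ≥ 1`, `A` skew `P`-periodic with `‖A‖ ≤ α₀` and lattice differences `‖A(y + e_τ, κ) − A(y, κ)‖ ≤ α₁`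
(`0 ≤ α₀, α₁`; the sup and GRADIENT currencies of the gauge representative — B8 (1.36) ∕ B11 (152) TYPE, hypotheses here), and every skew
`P`-periodic `Y`:

  `|dAction (e^{A}) Y (perWin d P) − hess 1 A Y (perWin d P)| ≤ ρ · dirL1 Y (periodBox P)`,

`ρ = #Plane(d)·(2c_loc + 64α₀α₁)`, `c_loc = 8α₀(2α₁+28α₀²) + 6δ(2α₁+24δα₀) + (2α₁+24δα₀)(2α₁+28α₀²) + 960δα₀²`, `δ = e^{α₀} − 1` — every term
a product of two small letters or the by-parts cost `64α₀α₁` of the cubic vertex; in the currencies `α₀ = α̂M⁻¹`, `α₁ = α̂₁M⁻²` it is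
`O(M⁻³)` (§5 `rho_currency`).  Proof: F45 `abs_dAction_vary_sub_hess_le_flat` + §4. [folklore] -/
theorem abs_dAction_vary_sub_hess_flat_le [Nonempty n] {P : ℕ} (hP : 1 ≤ P) {A : Site d → Fin d → Matrix n n ℂ} (hA : IsSkewDir A)
    (hAP : IsPeriodicDir A (P : ℤ)) {α₀ α₁ : ℝ} (hα₀ : 0 ≤ α₀) (hα₁ : 0 ≤ α₁)
    (hAα : ∀ y κ, ‖A y κ‖ ≤ α₀) (hA1 : ∀ (y : Site d) (κ τ : Fin d), ‖A (y + e τ) κ - A y κ‖ ≤ α₁)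
    {Y : Site d → Fin d → Matrix n n ℂ} (hY : IsSkewDir Y) (hYP : IsPeriodicDir Y (P : ℤ)) :
    |dAction (vary (flat (d := d) (n := n)) A 1) Y (perWin d P) - hess (flat (d := d) (n := n)) A Y (perWin d P)|
      ≤ (Fintype.card (T4AveragingDeficitWall.Plane d) : ℝ)
          * (2 * (8 * α₀ * (2 * α₁ + 28 * α₀ ^ 2) + 6 * (Real.exp α₀ - 1) * (2 * α₁ + 24 * (Real.exp α₀ - 1) * α₀)
              + (2 * α₁ + 24 * (Real.exp α₀ - 1) * α₀) * (2 * α₁ + 28 * α₀ ^ 2) + 960 * (Real.exp α₀ - 1) * α₀ ^ 2)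
            + 64 * α₀ * α₁)
        * dirL1 Y (periodBox (d := d) P) :=
  abs_dAction_vary_sub_hess_le_flat (isUnitaryCfg_flat (d := d) (n := n)) (smallField_flat_zero (d := d) (n := n)) A hY (perWin d P)
    fun _ hs => abs_hess_vary_sub_hess_flat_le hP hA hAP hα₀ hα₁ hAα hA1 hYP hs

/-! ## §5 The currency: every term of `ρ` is `O(M⁻³)` -/

omit [Fintype n] [DecidableEq n] in
/-- **THE CURRENCY CLAUSE `ρ ≤ ρ̂∕M³` OF F38 §4.**  With `M ≥ 1`, `0 ≤ α₀ ≤ α̂∕M`, `0 ≤ α₁ ≤ α̂₁∕M²`, `α̂ ≤ 1` and any `c_P ≥ 0` (`= #Plane`):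
`c_P·(2c_loc + 64α₀α₁) ≤ c_P·(144α̂α̂₁ + 5440α̂³ + 8α̂₁² + 304α̂²α̂₁ + 2688α̂⁴)∕M³` — `e^{α₀} − 1 ≤ 2α₀`, and every monomial `α₀^iα₁^j` of the
expanded bound has `M`-weight `i + 2j ≥ 3`. [folklore] -/
theorem rho_currency {M α₀ α₁ αh αh1 cP : ℝ} (hM : 1 ≤ M) (hα₀ : 0 ≤ α₀) (hα₀h : α₀ ≤ αh / M) (hα₁ : 0 ≤ α₁) (hα₁h : α₁ ≤ αh1 / M ^ 2)
    (hαh1 : αh ≤ 1) (hcP : 0 ≤ cP) :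
    cP * (2 * (8 * α₀ * (2 * α₁ + 28 * α₀ ^ 2) + 6 * (Real.exp α₀ - 1) * (2 * α₁ + 24 * (Real.exp α₀ - 1) * α₀)
              + (2 * α₁ + 24 * (Real.exp α₀ - 1) * α₀) * (2 * α₁ + 28 * α₀ ^ 2) + 960 * (Real.exp α₀ - 1) * α₀ ^ 2)
            + 64 * α₀ * α₁)
      ≤ cP * (144 * (αh * αh1) + 5440 * αh ^ 3 + 8 * (αh1 * αh1) + 304 * (αh1 * αh ^ 2) + 2688 * αh ^ 4) / M ^ 3 := by
  have hM0 : 0 < M := by linarith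
  have hM2 : 0 < M ^ 2 := by positivity
  have hM3 : 0 < M ^ 3 := by positivity
  have ha : α₀ * M ≤ αh := by rwa [le_div_iff₀ hM0] at hα₀h
  have hb : α₁ * M ^ 2 ≤ αh1 := by rwa [le_div_iff₀ hM2] at hα₁h
  have hαh0 : 0 ≤ αh := le_trans (by positivity) ha
  have hαh10 : 0 ≤ αh1 := le_trans (by positivity) hb
  have hα₀1 : α₀ ≤ 1 := by
    have h1 : α₀ ≤ α₀ * M := by nlinarith
    linarith
  -- Step 1: replace `δ = e^{α₀} − 1` by `2α₀`
  set δ : ℝ := Real.exp α₀ - 1 with hδdef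
  have hδ0 : 0 ≤ δ := by rw [hδdef]; linarith [Real.one_le_exp hα₀]
  have hδ : δ ≤ 2 * α₀ := Literature.NumberTheory.Sieve.SquarefreeSums.exp_sub_one_le_two_mul hα₀ hα₀1
  have step1 : 2 * (8 * α₀ * (2 * α₁ + 28 * α₀ ^ 2) + 6 * δ * (2 * α₁ + 24 * δ * α₀)
              + (2 * α₁ + 24 * δ * α₀) * (2 * α₁ + 28 * α₀ ^ 2) + 960 * δ * α₀ ^ 2) + 64 * α₀ * α₁
      ≤ 144 * (α₀ * α₁) + 5440 * α₀ ^ 3 + 8 * (α₁ * α₁) + 304 * (α₁ * α₀ ^ 2) + 2688 * α₀ ^ 4 := by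
    have i1 : 2 * α₁ + 24 * δ * α₀ ≤ 2 * α₁ + 48 * α₀ * α₀ := by
      have h24 : 24 * δ * α₀ ≤ 24 * (2 * α₀) * α₀ :=
        mul_le_mul_of_nonneg_right (mul_le_mul_of_nonneg_left hδ (by norm_num)) hα₀
      linarith
    have i0 : 0 ≤ 2 * α₁ + 24 * δ * α₀ := by positivity
    have j0 : 0 ≤ 2 * α₁ + 28 * α₀ ^ 2 := by positivity
    have j1 : 0 ≤ 2 * α₁ + 48 * α₀ * α₀ := by positivity
    have e1 : 6 * δ * (2 * α₁ + 24 * δ * α₀) ≤ 12 * α₀ * (2 * α₁ + 48 * α₀ * α₀) := by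
      have h6 : 6 * δ ≤ 6 * (2 * α₀) := mul_le_mul_of_nonneg_left hδ (by norm_num)
      calc 6 * δ * (2 * α₁ + 24 * δ * α₀) ≤ 6 * (2 * α₀) * (2 * α₁ + 48 * α₀ * α₀) := mul_le_mul h6 i1 i0 (by positivity)
        _ = 12 * α₀ * (2 * α₁ + 48 * α₀ * α₀) := by ring
    have e2 : (2 * α₁ + 24 * δ * α₀) * (2 * α₁ + 28 * α₀ ^ 2) ≤ (2 * α₁ + 48 * α₀ * α₀) * (2 * α₁ + 28 * α₀ ^ 2) :=
      mul_le_mul_of_nonneg_right i1 j0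
    have e3 : 960 * δ * α₀ ^ 2 ≤ 1920 * α₀ * α₀ ^ 2 := by
      have h960 : 960 * δ * α₀ ^ 2 ≤ 960 * (2 * α₀) * α₀ ^ 2 :=
        mul_le_mul_of_nonneg_right (mul_le_mul_of_nonneg_left hδ (by norm_num)) (sq_nonneg α₀)
      linarith
    have expand : 2 * (8 * α₀ * (2 * α₁ + 28 * α₀ ^ 2) + 12 * α₀ * (2 * α₁ + 48 * α₀ * α₀)
              + (2 * α₁ + 48 * α₀ * α₀) * (2 * α₁ + 28 * α₀ ^ 2) + 1920 * α₀ * α₀ ^ 2) + 64 * α₀ * α₁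
        = 144 * (α₀ * α₁) + 5440 * α₀ ^ 3 + 8 * (α₁ * α₁) + 304 * (α₁ * α₀ ^ 2) + 2688 * α₀ ^ 4 := by ring
    linarith
  -- Step 2: the monomials against `M³`
  have m01 : α₀ * α₁ * M ^ 3 ≤ αh * αh1 := by
    have : α₀ * α₁ * M ^ 3 = (α₀ * M) * (α₁ * M ^ 2) := by ring
    rw [this]; exact mul_le_mul ha hb (by positivity) hαh0
  have m03 : α₀ ^ 3 * M ^ 3 ≤ αh ^ 3 := by
    have : α₀ ^ 3 * M ^ 3 = (α₀ * M) ^ 3 := by ring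
    rw [this]; exact pow_le_pow_left₀ (by positivity) ha 3
  have hM34 : M ^ 3 ≤ M ^ 4 := pow_le_pow_right₀ hM (by norm_num)
  have m11 : α₁ * α₁ * M ^ 3 ≤ αh1 * αh1 := by
    have h4 : α₁ * α₁ * M ^ 4 ≤ αh1 * αh1 := by
      have : α₁ * α₁ * M ^ 4 = (α₁ * M ^ 2) * (α₁ * M ^ 2) := by ring
      rw [this]; exact mul_le_mul hb hb (by positivity) hαh10
    exact (mul_le_mul_of_nonneg_left hM34 (by positivity)).trans h4
  have m12 : α₁ * α₀ ^ 2 * M ^ 3 ≤ αh1 * αh ^ 2 := by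
    have h4 : α₁ * α₀ ^ 2 * M ^ 4 ≤ αh1 * αh ^ 2 := by
      have : α₁ * α₀ ^ 2 * M ^ 4 = (α₁ * M ^ 2) * (α₀ * M) ^ 2 := by ring
      rw [this]; exact mul_le_mul hb (pow_le_pow_left₀ (by positivity) ha 2) (by positivity) hαh10
    exact (mul_le_mul_of_nonneg_left hM34 (by positivity)).trans h4
  have m04 : α₀ ^ 4 * M ^ 3 ≤ αh ^ 4 := by
    have h4 : α₀ ^ 4 * M ^ 4 ≤ αh ^ 4 := by
      have : α₀ ^ 4 * M ^ 4 = (α₀ * M) ^ 4 := by ring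
      rw [this]; exact pow_le_pow_left₀ (by positivity) ha 4
    exact (mul_le_mul_of_nonneg_left hM34 (by positivity)).trans h4
  have key : (144 * (α₀ * α₁) + 5440 * α₀ ^ 3 + 8 * (α₁ * α₁) + 304 * (α₁ * α₀ ^ 2) + 2688 * α₀ ^ 4) * M ^ 3
      ≤ 144 * (αh * αh1) + 5440 * αh ^ 3 + 8 * (αh1 * αh1) + 304 * (αh1 * αh ^ 2) + 2688 * αh ^ 4 := by
    have expand : (144 * (α₀ * α₁) + 5440 * α₀ ^ 3 + 8 * (α₁ * α₁) + 304 * (α₁ * α₀ ^ 2) + 2688 * α₀ ^ 4) * M ^ 3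
        = 144 * (α₀ * α₁ * M ^ 3) + 5440 * (α₀ ^ 3 * M ^ 3) + 8 * (α₁ * α₁ * M ^ 3) + 304 * (α₁ * α₀ ^ 2 * M ^ 3)
          + 2688 * (α₀ ^ 4 * M ^ 3) := by ring
    rw [expand]
    linarith
  rw [le_div_iff₀ hM3]
  calc cP * (2 * (8 * α₀ * (2 * α₁ + 28 * α₀ ^ 2) + 6 * δ * (2 * α₁ + 24 * δ * α₀)
              + (2 * α₁ + 24 * δ * α₀) * (2 * α₁ + 28 * α₀ ^ 2) + 960 * δ * α₀ ^ 2) + 64 * α₀ * α₁) * M ^ 3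
      ≤ cP * (144 * (α₀ * α₁) + 5440 * α₀ ^ 3 + 8 * (α₁ * α₁) + 304 * (α₁ * α₀ ^ 2) + 2688 * α₀ ^ 4) * M ^ 3 :=
        mul_le_mul_of_nonneg_right (mul_le_mul_of_nonneg_left step1 hcP) hM3.le
    _ = cP * ((144 * (α₀ * α₁) + 5440 * α₀ ^ 3 + 8 * (α₁ * α₁) + 304 * (α₁ * α₀ ^ 2) + 2688 * α₀ ^ 4) * M ^ 3) := by ring
    _ ≤ cP * (144 * (αh * αh1) + 5440 * αh ^ 3 + 8 * (αh1 * αh1) + 304 * (αh1 * αh ^ 2) + 2688 * αh ^ 4) :=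
        mul_le_mul_of_nonneg_left key hcP

end

end Summit.QuantumFields.BalabanUV.T4Continuum.NE7ExpansionRemainderFlat
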